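import Mathlib
import HarnessLib
import Summits.Ventures.LatticeQCDFlow.Exactness.NCMCGeneralSpaceEventTauIntPositive
import Summits.Ventures.LatticeQCDFlow.Exactness.NCMCGeneralSpaceGammaMethodIntervalForm
import Summits.Ventures.LatticeQCDFlow.Exactness.NCMCGeneralSpaceOccupancyChainCLTHeatBath

/-!
# The exact-coverage theorems WITHOUT the positivity hypothesis: GEN-20's Γ-method coverage for events and for the NCMC lane, now unconditional under the Doeblin power; END TO END for the heat-bath shape

HONEST FRAMING: exact (Metropolis-corrected) sampling algorithms for lattice gauge theory;
figures of merit are autocorrelation/cost numbers at stated couplings and volumes; no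
continuum-physics claim.

Venture `LatticeQCDFlow` (cell pub-lqcd), topic `Exactness`; FANOUT row 13 (`eng-snf`, GEN-21).
NEW WORK of the cell, not a published result; no definition is introduced; nothing is cited as a
fact.  GEN-20's files `NCMCGeneralSpaceOccupancyChainGammaCoverage` (112),
`NCMCGeneralSpaceTauIntWindowConsistency` (113) and `NCMCGeneralSpaceGammaMethodIntervalForm` (114)
carry the hypothesis `0 < τ_int` (`hτ`) resp. `0 < σ²_f` (`hσ`).  GEN-21's
`NCMCGeneralSpaceEventTauIntPositive.tauInt_setACF_pos_of_nHit` proves `0 < τ_int(setACF κ π A)` for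
EVERY event under the same Doeblin power the theorems already assume — so for events, and in
particular for the NCMC lane's occupancy, the hypothesis is REDUNDANT.  This file restates the
theorems without it (pure plumbing) and closes the heat-bath lane END TO END.

## Content

* §1 events, any Doeblin power `ε • ν ≤ (nHit κ m)(z, ·)`, every initial law:
  **`tendsto_measure_standardizedIndicator_gamma_le_of_nHit_unconditional`** (112's frequency
  interval with the Γ-method `τ̂`), **`tendsto_measure_indicatorMean_mem_gammaInterval_of_nHit`**
  (114's interval form `|p̂_N − π(A)| ≤ z √(Γ̂(0) · 2 τ̂ / N)` for `f = 1_A`).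
* §2 the NCMC lane, two-step certificate `ε • ν ≤ (nHit Q 2)(z, ·)`, every initial state, NO `hτ`:
  **`CrooksPair.ncmc_dFocc_coverage_gamma_unconditional_of_sq`**,
  **`CrooksPair.ncmc_dFocc_mem_gammaInterval_unconditional_of_sq`**,
  **`CrooksPair.ncmc_dFocc_coverage_gamma_unconditional_of_exists_sq`**,
  **`CrooksPair.ncmc_dFocc_mem_gammaInterval_of_exists_sq`**.
* §3 **`CrooksPair.ncmc_heatBath_dFocc_mem_gammaInterval_of_ne`** — END TO END for the heat-bath
  (OBC / defect) shape: two bounded densities, heat-bath scans visiting every site between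
  switches, ANY Crooks pair, every `c ≠ ΔF`, windows `W_n → ∞`, `W_n³/n → 0`: from EVERY initial
  state `P_{δ_z}{ |dF_occ,n − ΔF| ≤ z √(2 τ̂_n / (n p̂_n (1 − p̂_n))) } → N(0,1)([−z, z])` — the
  engine's printed interval with the run's own Γ-method `τ̂` is asymptotically exact, with no
  hypothesis left on `τ_int`.

NOT CLAIMED: anything at `c = ΔF` with `W ≡ ΔF` (no Doeblin power); data-dependent windows beyond
GEN-20's clipped-bracket theorem; rates; any number of ours.
-/

namespace Summit.Ventures.LatticeQCDFlow.Exactness.GeneralNCMC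

open MeasureTheory ProbabilityTheory Set Filter Finset
open scoped ENNReal NNReal Topology

/-! ## §1 Events under a Doeblin power -/

section Event

variable {S : Type*} [MeasurableSpace S]
  {κ : Kernel S S} [IsMarkovKernel κ] {π : Measure S} [IsProbabilityMeasure π]
  {ν : Measure S} [IsProbabilityMeasure ν] {ε : ℝ≥0∞} {m : ℕ}

/-- **EXACT ASYMPTOTIC COVERAGE OF THE FREQUENCY INTERVAL WITH THE Γ-METHOD `τ̂` — unconditional.**
`κ` Markov, `π` invariant, `(nHit κ m)(z,·) ≥ ε ν` (`ε ≠ 0`, `0 < m`), `A` measurable with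
`0 < π(A) < 1`; windows `W_n → ∞`, `W_n³/n → 0`; `z > 0`; every initial law `μ₀`:
`P_{μ₀}{|√n (p̂_n − π(A)) · (√(2 τ̂_n p̂_n(1 − p̂_n)))⁻¹| ≤ z} → gaussianReal 0 1 (Icc (−z) z)`. -/
theorem tendsto_measure_standardizedIndicator_gamma_le_of_nHit_unconditional
    (hπ : Kernel.Invariant κ π) (hε : ε ≠ 0) (hmin : ∀ z, ε • ν ≤ nHit κ m z) (hm : 0 < m)
    {A : Set S} (hA : MeasurableSet A) (h0 : 0 < π.real A) (h1 : π.real A < 1)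
    {W : ℕ → ℕ} (hW : Tendsto W atTop atTop) (hW3 : Tendsto (fun N => (W N : ℝ) ^ 3 / N) atTop (𝓝 0))
    (μ₀ : Measure S) [IsProbabilityMeasure μ₀] {z : ℝ} (hz : 0 < z)
    [IsProbabilityMeasure (Kernel.trajMeasure (X := fun _ : ℕ => S) μ₀
        (fun n : ℕ => κ.comap (fun hh : (i : ↥(Finset.Iic n)) → S => hh ⟨n, Finset.mem_Iic.2 le_rfl⟩)
          (measurable_pi_apply _)))] :
    Tendsto (fun n : ℕ => (Kernel.trajMeasure (X := fun _ : ℕ => S) μ₀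
        (fun n : ℕ => κ.comap (fun hh : (i : ↥(Finset.Iic n)) → S => hh ⟨n, Finset.mem_Iic.2 le_rfl⟩)
          (measurable_pi_apply _)))
        {x : ℕ → S | |Real.sqrt n * ((∑ t ∈ range n, A.indicator (1 : S → ℝ) (x t)) / n - π.real A)
          * (Real.sqrt (2 * Scoring.tauIntWindow
              (Scoring.rhoHat (fun i => A.indicator (1 : S → ℝ) (x i)) n) (W n)
            * ((∑ t ∈ range n, A.indicator (1 : S → ℝ) (x t)) / n
            * (1 - (∑ t ∈ range n, A.indicator (1 : S → ℝ) (x t)) / n))))⁻¹| ≤ z})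
      atTop (𝓝 (gaussianReal 0 1 (Icc (-z) z))) :=
  tendsto_measure_standardizedIndicator_gamma_le_of_nHit hπ hε hmin hm hA h0 h1
    (tauInt_setACF_pos_of_nHit hπ hε hmin hm hA h0 h1) hW hW3 μ₀ hz

/-- **THE Γ-METHOD INTERVAL FOR AN EVENT FREQUENCY CONTAINS `π(A)` WITH ASYMPTOTICALLY NOMINAL
PROBABILITY — unconditional.**  Same hypotheses; for every initial law `μ₀`:
`P_{μ₀}{ |p̂_N − π(A)| ≤ z √(Γ̂_N(0) · 2 τ̂_{N,W_N} / N) } → gaussianReal 0 1 (Icc (−z) z)`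
(`Γ̂`, `τ̂` computed on the 0/1 series `1_A(X_t)`; `Γ̂_N(0) = p̂_N (1 − p̂_N)`). -/
theorem tendsto_measure_indicatorMean_mem_gammaInterval_of_nHit
    (hπ : Kernel.Invariant κ π) (hε : ε ≠ 0) (hmin : ∀ z, ε • ν ≤ nHit κ m z) (hm : 0 < m)
    {A : Set S} (hA : MeasurableSet A) (h0 : 0 < π.real A) (h1 : π.real A < 1)
    {W : ℕ → ℕ} (hW : Tendsto W atTop atTop) (hW3 : Tendsto (fun N => (W N : ℝ) ^ 3 / N) atTop (𝓝 0))
    (μ₀ : Measure S) [IsProbabilityMeasure μ₀] {z : ℝ} (hz : 0 < z)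
    [IsProbabilityMeasure (Kernel.trajMeasure (X := fun _ : ℕ => S) μ₀
        (fun n : ℕ => κ.comap (fun hh : (i : ↥(Finset.Iic n)) → S => hh ⟨n, Finset.mem_Iic.2 le_rfl⟩)
          (measurable_pi_apply _)))] :
    Tendsto (fun N : ℕ => (Kernel.trajMeasure (X := fun _ : ℕ => S) μ₀
        (fun n : ℕ => κ.comap (fun hh : (i : ↥(Finset.Iic n)) → S => hh ⟨n, Finset.mem_Iic.2 le_rfl⟩)
          (measurable_pi_apply _)))
        {x : ℕ → S | |(∑ t ∈ range N, A.indicator (1 : S → ℝ) (x t)) / N - π.real A|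
          ≤ z * Real.sqrt (Scoring.gammaHat (fun i => A.indicator (1 : S → ℝ) (x i)) N 0
            * (2 * Scoring.tauIntWindow
              (Scoring.rhoHat (fun i => A.indicator (1 : S → ℝ) (x i)) N) (W N)) / N)})
      atTop (𝓝 (gaussianReal 0 1 (Icc (-z) z))) := by
  have hf : Measurable (A.indicator (1 : S → ℝ)) := measurable_one.indicator hA
  have hC : ∀ y, |A.indicator (1 : S → ℝ) y| ≤ 1 := fun y => by
    by_cases hy : y ∈ A <;> simp [hy]
  have hmean : ∫ z, A.indicator (1 : S → ℝ) z ∂π = π.real A := integral_indicator_one hA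
  have hσ := greenKubo_variance_indicator_pos_of_nHit hπ hε hmin hm hA h0 h1
  have h := tendsto_measure_mean_mem_gammaInterval_of_nHit μ₀ hπ hε hmin hm hf hC hσ hW hW3 hz
  rw [hmean] at h
  exact h

end Event

/-! ## §2 The NCMC lane under the two-step certificate -/

section NCMC

variable {Ω E : Type*} [MeasurableSpace Ω] [MeasurableSpace E]
  {ν₀ ν₁ : Measure Ω} [IsFiniteMeasure ν₀] [IsFiniteMeasure ν₁]
  {κF κR : Kernel Ω E} [IsMarkovKernel κF] [IsMarkovKernel κR] {s e : E → Ω} {W : E → ℝ} {c : ℝ}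
  {T₀ T₁ : Kernel Ω Ω} [IsMarkovKernel T₀] [IsMarkovKernel T₁] {ε : ℝ≥0∞}
  {ν : Measure (Bool × Ω)} [IsProbabilityMeasure ν]

/-- **The lane's `τ_int(ρ_occ)` is positive under the two-step certificate** (Crooks pair, `T₀, T₁`
leaving `ν₀, ν₁` invariant, `ε • ν ≤ (nHit Q 2)(z, ·)`, `ε ≠ 0`, `e^{−ΔF} = Z₁/Z₀`). -/
theorem CrooksPair.ncmc_tauInt_occupancy_pos_of_sq (h : CrooksPair ν₀ ν₁ κF κR s e W)
    (h0 : ν₀ univ ≠ 0) (h1 : ν₁ univ ≠ 0) (hT₀ : Kernel.Invariant T₀ ν₀)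
    (hT₁ : Kernel.Invariant T₁ ν₁) (hε : ε ≠ 0)
    (hD : haveI := isMarkovKernel_switchKernel (κF := κF) (κR := κR) (c := c)
              h.measurable_W h.measurable_s h.measurable_e
      ∀ z, ε • ν ≤ nHit (switchKernel κF κR c W s e ∘ₖ levelKernel T₀ T₁) 2 z)
    {ΔF : ℝ} (hΔF : Real.exp (-ΔF) = ((ν₀ univ)⁻¹ * ν₁ univ).toReal) :
    haveI := isMarkovKernel_switchKernel (κF := κF) (κR := κR) (c := c)
      h.measurable_W h.measurable_s h.measurable_e
    0 < Scoring.tauInt (setACF (switchKernel κF κR c W s e ∘ₖ levelKernel T₀ T₁)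
        ((jointWeight c ν₀ ν₁ univ)⁻¹ • jointWeight c ν₀ ν₁) (targetLevel Ω)) := by
  haveI := isMarkovKernel_switchKernel (κF := κF) (κR := κR) (c := c)
    h.measurable_W h.measurable_s h.measurable_e
  haveI := isMarkovKernel_levelKernel T₀ T₁
  haveI := isProbabilityMeasure_jointLaw c ν₀ ν₁ h0
  have hπ : Kernel.Invariant (switchKernel κF κR c W s e ∘ₖ levelKernel T₀ T₁)
      ((jointWeight c ν₀ ν₁ univ)⁻¹ • jointWeight c ν₀ ν₁) :=
    invariant_smul _ (iteration_invariant h hT₀ hT₁ c) _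
  have hσeq := jointLaw_real_targetLevel c ν₀ ν₁ h0 h1 hΔF
  have hp0 : 0 < ((jointWeight c ν₀ ν₁ univ)⁻¹ • jointWeight c ν₀ ν₁).real (targetLevel Ω) := by
    rw [hσeq]; exact Real.sigmoid_pos _
  have hp1 : ((jointWeight c ν₀ ν₁ univ)⁻¹ • jointWeight c ν₀ ν₁).real (targetLevel Ω) < 1 := by
    rw [hσeq]; exact Real.sigmoid_lt_one _
  exact tauInt_setACF_pos_of_nHit hπ hε hD (by norm_num) measurableSet_targetLevel hp0 hp1

/-- **112's `ncmc_dFocc_coverage_gamma_of_sq` WITHOUT `hτ`**: from EVERY initial state,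
`P_{δ_{z₀}}{|√n (dF_occ,n − ΔF) · √(p̂_n(1 − p̂_n)/(2 τ̂_n))| ≤ z} → gaussianReal 0 1 (Icc (−z) z)`. -/
theorem CrooksPair.ncmc_dFocc_coverage_gamma_unconditional_of_sq (h : CrooksPair ν₀ ν₁ κF κR s e W)
    (h0 : ν₀ univ ≠ 0) (h1 : ν₁ univ ≠ 0) (hT₀ : Kernel.Invariant T₀ ν₀)
    (hT₁ : Kernel.Invariant T₁ ν₁) (hε : ε ≠ 0)
    (hD : haveI := isMarkovKernel_switchKernel (κF := κF) (κR := κR) (c := c)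
              h.measurable_W h.measurable_s h.measurable_e
      ∀ z, ε • ν ≤ nHit (switchKernel κF κR c W s e ∘ₖ levelKernel T₀ T₁) 2 z)
    {ΔF : ℝ} (hΔF : Real.exp (-ΔF) = ((ν₀ univ)⁻¹ * ν₁ univ).toReal)
    {Wn : ℕ → ℕ} (hW : Tendsto Wn atTop atTop) (hW3 : Tendsto (fun N => (Wn N : ℝ) ^ 3 / N) atTop (𝓝 0))
    (z₀ : Bool × Ω) {z : ℝ} (hz : 0 < z)
    [hP : haveI := isMarkovKernel_switchKernel (κF := κF) (κR := κR) (c := c)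
              h.measurable_W h.measurable_s h.measurable_e
      haveI := isMarkovKernel_levelKernel T₀ T₁
      IsProbabilityMeasure (Kernel.trajMeasure (X := fun _ : ℕ => Bool × Ω) (Measure.dirac z₀)
        (fun n : ℕ => (switchKernel κF κR c W s e ∘ₖ levelKernel T₀ T₁).comap
          (fun hh : (j : ↥(Finset.Iic n)) → Bool × Ω => hh ⟨n, Finset.mem_Iic.2 le_rfl⟩)
          (measurable_pi_apply _)))] :
    haveI := isMarkovKernel_switchKernel (κF := κF) (κR := κR) (c := c)
      h.measurable_W h.measurable_s h.measurable_e
    haveI := isMarkovKernel_levelKernel T₀ T₁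
    Tendsto (fun n : ℕ => (Kernel.trajMeasure (X := fun _ : ℕ => Bool × Ω) (Measure.dirac z₀)
        (fun n : ℕ => (switchKernel κF κR c W s e ∘ₖ levelKernel T₀ T₁).comap
          (fun hh : (j : ↥(Finset.Iic n)) → Bool × Ω => hh ⟨n, Finset.mem_Iic.2 le_rfl⟩)
          (measurable_pi_apply _)))
        {x : ℕ → Bool × Ω | |Real.sqrt n * ((c - Real.log
            ((∑ i ∈ range n, (targetLevel Ω).indicator (1 : Bool × Ω → ℝ) (x i)) / n /
              (1 - (∑ i ∈ range n, (targetLevel Ω).indicator (1 : Bool × Ω → ℝ) (x i)) / n)))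
            - ΔF)
          * Real.sqrt ((∑ i ∈ range n, (targetLevel Ω).indicator (1 : Bool × Ω → ℝ) (x i)) / n
            * (1 - (∑ i ∈ range n, (targetLevel Ω).indicator (1 : Bool × Ω → ℝ) (x i)) / n)
            / (2 * Scoring.tauIntWindow (Scoring.rhoHat
              (fun i => (targetLevel Ω).indicator (1 : Bool × Ω → ℝ) (x i)) n) (Wn n)))| ≤ z})
      atTop (𝓝 (gaussianReal 0 1 (Icc (-z) z))) :=
  h.ncmc_dFocc_coverage_gamma_of_sq h0 h1 hT₀ hT₁ hε hD hΔF
    (h.ncmc_tauInt_occupancy_pos_of_sq h0 h1 hT₀ hT₁ hε hD hΔF) hW hW3 z₀ hz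

/-- **114's `ncmc_dFocc_mem_gammaInterval_of_sq` WITHOUT `hτ`** — the INTERVAL FORM from every initial
state: `P_{δ_{z₀}}{ |dF_occ,n − ΔF| ≤ z √(2 τ̂_n / (n p̂_n (1 − p̂_n))) } → gaussianReal 0 1 (Icc (−z) z)`. -/
theorem CrooksPair.ncmc_dFocc_mem_gammaInterval_unconditional_of_sq
    (h : CrooksPair ν₀ ν₁ κF κR s e W)
    (h0 : ν₀ univ ≠ 0) (h1 : ν₁ univ ≠ 0) (hT₀ : Kernel.Invariant T₀ ν₀)
    (hT₁ : Kernel.Invariant T₁ ν₁) (hε : ε ≠ 0)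
    (hD : haveI := isMarkovKernel_switchKernel (κF := κF) (κR := κR) (c := c)
              h.measurable_W h.measurable_s h.measurable_e
      ∀ z, ε • ν ≤ nHit (switchKernel κF κR c W s e ∘ₖ levelKernel T₀ T₁) 2 z)
    {ΔF : ℝ} (hΔF : Real.exp (-ΔF) = ((ν₀ univ)⁻¹ * ν₁ univ).toReal)
    {Wn : ℕ → ℕ} (hW : Tendsto Wn atTop atTop) (hW3 : Tendsto (fun N => (Wn N : ℝ) ^ 3 / N) atTop (𝓝 0))
    (z₀ : Bool × Ω) {z : ℝ} (hz : 0 < z)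
    [hP : haveI := isMarkovKernel_switchKernel (κF := κF) (κR := κR) (c := c)
              h.measurable_W h.measurable_s h.measurable_e
      haveI := isMarkovKernel_levelKernel T₀ T₁
      IsProbabilityMeasure (Kernel.trajMeasure (X := fun _ : ℕ => Bool × Ω) (Measure.dirac z₀)
        (fun n : ℕ => (switchKernel κF κR c W s e ∘ₖ levelKernel T₀ T₁).comap
          (fun hh : (j : ↥(Finset.Iic n)) → Bool × Ω => hh ⟨n, Finset.mem_Iic.2 le_rfl⟩)
          (measurable_pi_apply _)))] :
    haveI := isMarkovKernel_switchKernel (κF := κF) (κR := κR) (c := c)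
      h.measurable_W h.measurable_s h.measurable_e
    haveI := isMarkovKernel_levelKernel T₀ T₁
    Tendsto (fun n : ℕ => (Kernel.trajMeasure (X := fun _ : ℕ => Bool × Ω) (Measure.dirac z₀)
        (fun n : ℕ => (switchKernel κF κR c W s e ∘ₖ levelKernel T₀ T₁).comap
          (fun hh : (j : ↥(Finset.Iic n)) → Bool × Ω => hh ⟨n, Finset.mem_Iic.2 le_rfl⟩)
          (measurable_pi_apply _)))
        {x : ℕ → Bool × Ω | |(c - Real.log
            ((∑ i ∈ range n, (targetLevel Ω).indicator (1 : Bool × Ω → ℝ) (x i)) / n /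
              (1 - (∑ i ∈ range n, (targetLevel Ω).indicator (1 : Bool × Ω → ℝ) (x i)) / n)))
            - ΔF|
          ≤ z * Real.sqrt (2 * Scoring.tauIntWindow (Scoring.rhoHat
              (fun i => (targetLevel Ω).indicator (1 : Bool × Ω → ℝ) (x i)) n) (Wn n)
            / (n * ((∑ i ∈ range n, (targetLevel Ω).indicator (1 : Bool × Ω → ℝ) (x i)) / n
              * (1 - (∑ i ∈ range n, (targetLevel Ω).indicator (1 : Bool × Ω → ℝ) (x i)) / n))))})
      atTop (𝓝 (gaussianReal 0 1 (Icc (-z) z))) :=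
  h.ncmc_dFocc_mem_gammaInterval_of_sq h0 h1 hT₀ hT₁ hε hD hΔF
    (h.ncmc_tauInt_occupancy_pos_of_sq h0 h1 hT₀ hT₁ hε hD hΔF) hW hW3 z₀ hz

omit [IsProbabilityMeasure ν] in
/-- **113's `ncmc_dFocc_coverage_gamma_of_exists_sq` WITHOUT `hτ`** (the EXISTENTIAL two-step
certificate, e.g. GEN-18's `ncmc_exists_sq_doeblin_of_ne` for every `c ≠ ΔF`). -/
theorem CrooksPair.ncmc_dFocc_coverage_gamma_unconditional_of_exists_sq
    (h : CrooksPair ν₀ ν₁ κF κR s e W)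
    (h0 : ν₀ univ ≠ 0) (h1 : ν₁ univ ≠ 0) (hT₀ : Kernel.Invariant T₀ ν₀)
    (hT₁ : Kernel.Invariant T₁ ν₁)
    (hex : ∃ (ε : ℝ≥0∞) (ν : Measure (Bool × Ω)), IsProbabilityMeasure ν ∧ ε ≠ 0 ∧
      ∀ z, ε • ν ≤ nHit (switchKernel κF κR c W s e ∘ₖ levelKernel T₀ T₁) 2 z)
    {ΔF : ℝ} (hΔF : Real.exp (-ΔF) = ((ν₀ univ)⁻¹ * ν₁ univ).toReal)
    {Wn : ℕ → ℕ} (hW : Tendsto Wn atTop atTop) (hW3 : Tendsto (fun N => (Wn N : ℝ) ^ 3 / N) atTop (𝓝 0))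
    (z₀ : Bool × Ω) {z : ℝ} (hz : 0 < z)
    [hP : haveI := isMarkovKernel_switchKernel (κF := κF) (κR := κR) (c := c)
              h.measurable_W h.measurable_s h.measurable_e
      haveI := isMarkovKernel_levelKernel T₀ T₁
      IsProbabilityMeasure (Kernel.trajMeasure (X := fun _ : ℕ => Bool × Ω) (Measure.dirac z₀)
        (fun n : ℕ => (switchKernel κF κR c W s e ∘ₖ levelKernel T₀ T₁).comap
          (fun hh : (j : ↥(Finset.Iic n)) → Bool × Ω => hh ⟨n, Finset.mem_Iic.2 le_rfl⟩)
          (measurable_pi_apply _)))] :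
    haveI := isMarkovKernel_switchKernel (κF := κF) (κR := κR) (c := c)
      h.measurable_W h.measurable_s h.measurable_e
    haveI := isMarkovKernel_levelKernel T₀ T₁
    Tendsto (fun n : ℕ => (Kernel.trajMeasure (X := fun _ : ℕ => Bool × Ω) (Measure.dirac z₀)
        (fun n : ℕ => (switchKernel κF κR c W s e ∘ₖ levelKernel T₀ T₁).comap
          (fun hh : (j : ↥(Finset.Iic n)) → Bool × Ω => hh ⟨n, Finset.mem_Iic.2 le_rfl⟩)
          (measurable_pi_apply _)))
        {x : ℕ → Bool × Ω | |Real.sqrt n * ((c - Real.log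
            ((∑ i ∈ range n, (targetLevel Ω).indicator (1 : Bool × Ω → ℝ) (x i)) / n /
              (1 - (∑ i ∈ range n, (targetLevel Ω).indicator (1 : Bool × Ω → ℝ) (x i)) / n)))
            - ΔF)
          * Real.sqrt ((∑ i ∈ range n, (targetLevel Ω).indicator (1 : Bool × Ω → ℝ) (x i)) / n
            * (1 - (∑ i ∈ range n, (targetLevel Ω).indicator (1 : Bool × Ω → ℝ) (x i)) / n)
            / (2 * Scoring.tauIntWindow (Scoring.rhoHat
              (fun i => (targetLevel Ω).indicator (1 : Bool × Ω → ℝ) (x i)) n) (Wn n)))| ≤ z})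
      atTop (𝓝 (gaussianReal 0 1 (Icc (-z) z))) := by
  obtain ⟨ε, ν, hν, hε, hD⟩ := hex
  haveI := hν
  exact h.ncmc_dFocc_coverage_gamma_unconditional_of_sq h0 h1 hT₀ hT₁ hε hD hΔF hW hW3 z₀ hz

omit [IsProbabilityMeasure ν] in
/-- **The INTERVAL FORM with the EXISTENTIAL two-step certificate, no `hτ`.** -/
theorem CrooksPair.ncmc_dFocc_mem_gammaInterval_of_exists_sq
    (h : CrooksPair ν₀ ν₁ κF κR s e W)
    (h0 : ν₀ univ ≠ 0) (h1 : ν₁ univ ≠ 0) (hT₀ : Kernel.Invariant T₀ ν₀)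
    (hT₁ : Kernel.Invariant T₁ ν₁)
    (hex : ∃ (ε : ℝ≥0∞) (ν : Measure (Bool × Ω)), IsProbabilityMeasure ν ∧ ε ≠ 0 ∧
      ∀ z, ε • ν ≤ nHit (switchKernel κF κR c W s e ∘ₖ levelKernel T₀ T₁) 2 z)
    {ΔF : ℝ} (hΔF : Real.exp (-ΔF) = ((ν₀ univ)⁻¹ * ν₁ univ).toReal)
    {Wn : ℕ → ℕ} (hW : Tendsto Wn atTop atTop) (hW3 : Tendsto (fun N => (Wn N : ℝ) ^ 3 / N) atTop (𝓝 0))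
    (z₀ : Bool × Ω) {z : ℝ} (hz : 0 < z)
    [hP : haveI := isMarkovKernel_switchKernel (κF := κF) (κR := κR) (c := c)
              h.measurable_W h.measurable_s h.measurable_e
      haveI := isMarkovKernel_levelKernel T₀ T₁
      IsProbabilityMeasure (Kernel.trajMeasure (X := fun _ : ℕ => Bool × Ω) (Measure.dirac z₀)
        (fun n : ℕ => (switchKernel κF κR c W s e ∘ₖ levelKernel T₀ T₁).comap
          (fun hh : (j : ↥(Finset.Iic n)) → Bool × Ω => hh ⟨n, Finset.mem_Iic.2 le_rfl⟩)
          (measurable_pi_apply _)))] :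
    haveI := isMarkovKernel_switchKernel (κF := κF) (κR := κR) (c := c)
      h.measurable_W h.measurable_s h.measurable_e
    haveI := isMarkovKernel_levelKernel T₀ T₁
    Tendsto (fun n : ℕ => (Kernel.trajMeasure (X := fun _ : ℕ => Bool × Ω) (Measure.dirac z₀)
        (fun n : ℕ => (switchKernel κF κR c W s e ∘ₖ levelKernel T₀ T₁).comap
          (fun hh : (j : ↥(Finset.Iic n)) → Bool × Ω => hh ⟨n, Finset.mem_Iic.2 le_rfl⟩)
          (measurable_pi_apply _)))
        {x : ℕ → Bool × Ω | |(c - Real.log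
            ((∑ i ∈ range n, (targetLevel Ω).indicator (1 : Bool × Ω → ℝ) (x i)) / n /
              (1 - (∑ i ∈ range n, (targetLevel Ω).indicator (1 : Bool × Ω → ℝ) (x i)) / n)))
            - ΔF|
          ≤ z * Real.sqrt (2 * Scoring.tauIntWindow (Scoring.rhoHat
              (fun i => (targetLevel Ω).indicator (1 : Bool × Ω → ℝ) (x i)) n) (Wn n)
            / (n * ((∑ i ∈ range n, (targetLevel Ω).indicator (1 : Bool × Ω → ℝ) (x i)) / n
              * (1 - (∑ i ∈ range n, (targetLevel Ω).indicator (1 : Bool × Ω → ℝ) (x i)) / n))))})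
      atTop (𝓝 (gaussianReal 0 1 (Icc (-z) z))) := by
  obtain ⟨ε, ν, hν, hε, hD⟩ := hex
  haveI := hν
  exact h.ncmc_dFocc_mem_gammaInterval_unconditional_of_sq h0 h1 hT₀ hT₁ hε hD hΔF hW hW3 z₀ hz

end NCMC

/-! ## §3 END TO END for the heat-bath shape -/

section HeatBath

variable {ι : Type*} [Fintype ι] [DecidableEq ι] {X : ι → Type*} [∀ i, MeasurableSpace (X i)]
variable {μ : Π i, Measure (X i)} [∀ i, IsProbabilityMeasure (μ i)]

/-- **END TO END, HEAT-BATH SHAPE: THE PRINTED INTERVAL `dF_occ ± z √(2 τ̂ / (n p̂ (1 − p̂)))` IS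
ASYMPTOTICALLY EXACT FROM EVERY INITIAL STATE, FOR EVERY `c ≠ ΔF`, WITH NO HYPOTHESIS ON `τ_int`.**
Prior `p₀ · ⊗μ`, target `p₁ · ⊗μ` (`0 < m_k ≤ p_k ≤ M_k < ∞`), heat-bath scans over lists visiting
every site between switches, ANY Crooks pair, `e^{−ΔF} = Z₁/Z₀`, `c ≠ ΔF`, windows `W_n → ∞`,
`W_n³/n → 0`, `z > 0`: for every initial state `z₀`,
`P_{δ_{z₀}}{ |dF_occ,n − ΔF| ≤ z √(2 τ̂_n / (n p̂_n (1 − p̂_n))) } → gaussianReal 0 1 (Icc (−z) z)`. -/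
theorem CrooksPair.ncmc_heatBath_dFocc_mem_gammaInterval_of_ne {p₀ p₁ : (Π j, X j) → ℝ≥0∞}
    {m₀ M₀ m₁ M₁ : ℝ≥0∞}
    (hp₀ : Measurable p₀) (hm₀0 : m₀ ≠ 0) (hM₀ : M₀ ≠ ∞) (hmp₀ : ∀ ω, m₀ ≤ p₀ ω)
    (hpM₀ : ∀ ω, p₀ ω ≤ M₀) {l₀ : List ι} (hl₀ : ∀ i, i ∈ l₀)
    (hp₁ : Measurable p₁) (hm₁0 : m₁ ≠ 0) (hM₁ : M₁ ≠ ∞) (hmp₁ : ∀ ω, m₁ ≤ p₁ ω)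
    (hpM₁ : ∀ ω, p₁ ω ≤ M₁) {l₁ : List ι} (hl₁ : ∀ i, i ∈ l₁)
    {E : Type*} [MeasurableSpace E] {κF κR : Kernel (Π j, X j) E} [IsMarkovKernel κF]
    [IsMarkovKernel κR] {s e : E → (Π j, X j)} {W : E → ℝ}
    (h : CrooksPair ((Measure.pi μ).withDensity p₀) ((Measure.pi μ).withDensity p₁) κF κR s e W)
    {c ΔF : ℝ}
    (hΔF : Real.exp (-ΔF) = ((((Measure.pi μ).withDensity p₀) univ)⁻¹ *
      ((Measure.pi μ).withDensity p₁) univ).toReal) (hc : c ≠ ΔF)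
    {Wn : ℕ → ℕ} (hW : Tendsto Wn atTop atTop)
    (hW3 : Tendsto (fun N => (Wn N : ℝ) ^ 3 / N) atTop (𝓝 0)) {z : ℝ} (hz : 0 < z) :
    ∃ (_ : IsMarkovKernel (switchKernel κF κR c W s e))
      (_ : IsMarkovKernel (levelKernel (cycle (l₀.map (siteHeatBath μ p₀)))
        (cycle (l₁.map (siteHeatBath μ p₁))))),
      ∀ (z₀ : Bool × (Π j, X j))
        [IsProbabilityMeasure (Kernel.trajMeasure (X := fun _ : ℕ => Bool × (Π j, X j))
            (Measure.dirac z₀)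
            (fun n : ℕ => (switchKernel κF κR c W s e ∘ₖ
              levelKernel (cycle (l₀.map (siteHeatBath μ p₀))) (cycle (l₁.map (siteHeatBath μ p₁)))).comap
              (fun hh : (j : ↥(Finset.Iic n)) → Bool × (Π j, X j) => hh ⟨n, Finset.mem_Iic.2 le_rfl⟩)
              (measurable_pi_apply _)))],
        Tendsto (fun n : ℕ => (Kernel.trajMeasure (X := fun _ : ℕ => Bool × (Π j, X j))
            (Measure.dirac z₀)
            (fun n : ℕ => (switchKernel κF κR c W s e ∘ₖ
              levelKernel (cycle (l₀.map (siteHeatBath μ p₀))) (cycle (l₁.map (siteHeatBath μ p₁)))).comap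
              (fun hh : (j : ↥(Finset.Iic n)) → Bool × (Π j, X j) => hh ⟨n, Finset.mem_Iic.2 le_rfl⟩)
              (measurable_pi_apply _)))
            {x : ℕ → Bool × (Π j, X j) | |(c - Real.log
                ((∑ i ∈ range n, (targetLevel (Π j, X j)).indicator
                    (1 : Bool × (Π j, X j) → ℝ) (x i)) / n /
                  (1 - (∑ i ∈ range n, (targetLevel (Π j, X j)).indicator
                    (1 : Bool × (Π j, X j) → ℝ) (x i)) / n))) - ΔF|
              ≤ z * Real.sqrt (2 * Scoring.tauIntWindow (Scoring.rhoHat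
                  (fun i => (targetLevel (Π j, X j)).indicator (1 : Bool × (Π j, X j) → ℝ) (x i)) n)
                  (Wn n)
                / (n * ((∑ i ∈ range n, (targetLevel (Π j, X j)).indicator
                    (1 : Bool × (Π j, X j) → ℝ) (x i)) / n
                  * (1 - (∑ i ∈ range n, (targetLevel (Π j, X j)).indicator
                    (1 : Bool × (Π j, X j) → ℝ) (x i)) / n))))})
          atTop (𝓝 (gaussianReal 0 1 (Icc (-z) z))) := by
  obtain ⟨hMk₀, hfin₀, -, -, h0, -, hK₀, -⟩ := heatBathSweep_package (μ := μ) hp₀ hm₀0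
    hM₀ hmp₀ hpM₀ hl₀
  obtain ⟨hMk₁, hfin₁, -, -, h1, -, hK₁, -⟩ := heatBathSweep_package (μ := μ) hp₁ hm₁0
    hM₁ hmp₁ hpM₁ hl₁
  obtain ⟨hmfin₀, hm₀, hmin₀, hac₀⟩ := heatBath_minorising (μ := μ) hp₀ hm₀0 hM₀ hmp₀ hpM₀ hl₀
  obtain ⟨hmfin₁, hm₁, hmin₁, hac₁⟩ := heatBath_minorising (μ := μ) hp₁ hm₁0 hM₁ hmp₁ hpM₁ hl₁
  haveI := hMk₀
  haveI := hMk₁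
  haveI := hfin₀
  haveI := hfin₁
  haveI := hmfin₀
  haveI := hmfin₁
  refine ⟨isMarkovKernel_switchKernel (κF := κF) (κR := κR) (c := c)
      h.measurable_W h.measurable_s h.measurable_e, isMarkovKernel_levelKernel _ _,
    fun z₀ _ => ?_⟩
  exact h.ncmc_dFocc_mem_gammaInterval_of_exists_sq h0 h1 hK₀ hK₁
    (h.ncmc_exists_sq_doeblin hm₀ hm₁ hmin₀ hmin₁ hac₀ hac₁ c
      (h.bind_work_ne_ne_zero_of_ne h0 hΔF hc)) hΔF hW hW3 z₀ hz

end HeatBath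

end Summit.Ventures.LatticeQCDFlow.Exactness.GeneralNCMC
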